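import Summits.QuantumFields.BalabanUV.Gaps.EndDrawdownLinearBarrier
import Summits.QuantumFields.BalabanUV.Gaps.EndDrawdownLinearThreshold

/-!
# Gaps / EndDrawdownLinearThresholdRenorm — THE OCTAL THRESHOLD BY BLOCK RENORMALISATION: with the barrier criterion
# (`EndDrawdownLinearBarrier.endPossibleLin_iff_barrier`) the threshold constant `C⋆` of GEN 10's octal staircase `bOct j = −2^{−t}` on block
# `t = ⌊log₈(j+1)⌋` (`7·8^t` indices; `EndDrawdownLinearThreshold.exists_threshold_bOct`: `C⋆ ∈ [1∕2, 2]`) is squeezed by ONE EXPLICIT EULER STEP PER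
# BLOCK of the scaled barrier height `κ_t := ℓ(8^t − 1) ∕ 4^t`.  NECESSITY: a barrier entering block `t` at height `≥ (9∕4)·C²·4^t` gains at least
# `7·8^t·(2^{−t} − C∕√ℓ) ≥ (7∕3)·4^t` across the block, which is `≥ (9∕4)C²·(4^{t+1} − 4^t)` iff `C² ≤ 28∕81`; so for `C ≤ 2√7∕9 ≈ 0.588` every
# barrier above `(9∕4)C²` is UNBOUNDED — **`not_endPossibleLin_bOct_of_sq_le`**.  SUFFICIENCY: the backward height recursion
# `κ_t = R(κ_{t+1}) := 4κ_{t+1} − 7 + (7C∕2)∕√κ_{t+1}` (slope of block `t` evaluated at the block's END, where the help is least) from `κ_T = C²`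
# (the floor of the tail rate `2^{−T}`) gains `≥ 3C² − 7∕2` per block when `C² ≥ 7∕12`, so for `C² > 7∕6` it reaches every level and the
# piecewise-linear interpolant is a barrier — **`endPossibleLin_bOct_of_lt_sq`**.  Hence **`exists_threshold_bOct_renorm`**:
# `C⋆ ∈ [2√7∕9, √(7∕6)] ≈ [0.588, 1.080]` IN PLACE OF `[1∕2, 2]`.  REMARK (NOT a theorem of this file): block `t` is an `8^{−t}`-step Euler scheme of
# duration `7` for `ẇ = ±(1 − C∕√w)`; finer substeps squeeze further, and the formal limit — the saddle-node of `w ↦ 4·Φ₇(w)`, `Φ` the flow of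
# `ẇ = C∕√w − 1`, tangency at `√w = (7∕3)·C` — suggests `C⋆² = 84∕(77 + 72·log 2)`, `C⋆ ≈ 0.8136`: a float-screened HEURISTIC of the cell's reading
# note only (cell pub-balaban-gaps, seat g1-p3 GEN 11, rows CAP ∕ tail ∕ (D4) «split ∕ weakening»; own leaf; file 27 of «the one-loop interface of
# the END statement»)

HONEST FRAMING (cell rule, page 1 of everything): [folklore] window arithmetic for ONE explicit toy sequence fed to the kernel-checked barrier
criterion; `EndPossibleLin` is a quantified READING of the cell's END-grade statement over Bałaban-free data `(b, C, γ₀)`, not a binder; the (AF-1)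
linear road is a located UNPRINTED hypothesis shape ([I] (2.12)–(2.14) ∕ [II] p. 8 after (1.29); `CapSignsConstRoad` §1); NOTHING of Bałaban's
table is certified (NODE-O 0∕1, CAP coefficients 0); words ∕ odds of rows CAP ∕ tail ∕ (D4) ∕ (D1) UNCHANGED; 0∕6 binders; one finite T⁴; NOT [I]
Thm 2, NOT `BetaPertH`, NOT the continuum limit, NOT Clay.

CITATION HEADER (tags CONTEXT ONLY).  [I] = T. Bałaban, Commun. Math. Phys. **109** (1987) 249–301 [Balaban1987RG1]: (0.20) p. 256, Thm 2
p. 259 (first sentence), (2.12)–(2.14) p. 268.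
-/

namespace Summit.QuantumFields.BalabanUV.Gaps.EndDrawdownLinearThresholdRenorm

open Summit.QuantumFields.BalabanUV.Gaps.EndDrawdownLinearRoad
open Summit.QuantumFields.BalabanUV.Gaps.EndDrawdownCooperatorExtremal
open Summit.QuantumFields.BalabanUV.Gaps.EndDrawdownLinearBarrier
open Summit.QuantumFields.BalabanUV.Gaps.EndDrawdownLinearThreshold
open Finset

noncomputable section

/-! ## §0 Block bookkeeping for the octal staircase -/

/-- Block `t+1` starts `7·8^t` indices after block `t`: `bs8 (t+1) = bs8 t + 7·8^t`. [folklore] -/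
theorem bs8_succ (t : ℕ) : bs8 (t + 1) = bs8 t + 7 * 8 ^ t := by
  have h1 := bs8_add_one t; have h2 := bs8_add_one (t + 1)
  have h3 : 8 ^ (t + 1) = 8 * 8 ^ t := by rw [pow_succ, mul_comm]
  omega

/-- Every index lies in its block: `bs8 (blk8 i) ≤ i < bs8 (blk8 i + 1)`. [folklore] -/
theorem mem_block (i : ℕ) : bs8 (blk8 i) ≤ i ∧ i < bs8 (blk8 i + 1) :=
  ⟨bs8_le_iff.mpr le_rfl, not_le.mp fun h => absurd (bs8_le_iff.mp h) (by omega)⟩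

/-- The next index is in the same block or opens the next one. [folklore] -/
theorem blk8_succ (i : ℕ) : (blk8 (i + 1) = blk8 i ∧ i + 1 < bs8 (blk8 i + 1)) ∨ (blk8 (i + 1) = blk8 i + 1 ∧ i + 1 = bs8 (blk8 i + 1)) := by
  obtain ⟨h1, h2⟩ := mem_block i
  by_cases h : i + 1 < bs8 (blk8 i + 1)
  · left
    have ha := bs8_add_one (blk8 i); have hb := bs8_add_one (blk8 i + 1)
    exact ⟨blk8_of_mem (by omega) (by omega), h⟩
  · right
    have heq : i + 1 = bs8 (blk8 i + 1) := by omega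
    have hb := bs8_add_one (blk8 i + 1); have hc := bs8_add_one (blk8 i + 2)
    have hp : 8 ^ (blk8 i + 2) = 8 * 8 ^ (blk8 i + 1) := by rw [pow_succ, mul_comm]
    exact ⟨blk8_of_mem (by omega) (by omega), heq⟩

/-- Real powers: `8^t = 2^t · 4^t`. [folklore] -/
theorem eight_pow (t : ℕ) : (8 : ℝ) ^ t = 2 ^ t * 4 ^ t := by rw [← mul_pow]; norm_num

/-- `√(c·4^t) = √c · 2^t` for `c ≥ 0`. [folklore] -/
theorem sqrt_mul_four_pow {c : ℝ} (hc : 0 ≤ c) (t : ℕ) : Real.sqrt (c * 4 ^ t) = Real.sqrt c * 2 ^ t := by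
  rw [(show (4 : ℝ) ^ t = (2 ^ t) ^ 2 by rw [← pow_mul, mul_comm, pow_mul]; norm_num), Real.sqrt_mul hc, Real.sqrt_sq (by positivity)]

/-! ## §1 NECESSITY by one Euler step per block: `C² ≤ 28∕81` is impossible -/

section Necessity

variable {C A Y : ℝ} {ℓ : ℕ → ℝ}

/-- **ONE BLOCK, LOWER EULER STEP** · a barrier for `(bOct, C)` entering block `t` at height `m := ℓ(bs8 t) ≥ (9∕4)·C²·4^t` (`C > 0`) rises inside
the block at speed `≥ 2^{−t} − C∕√m ≥ 2^{−t}∕3` (the help only shrinks as `ℓ` grows), so `ℓ(bs8 t + d) ≥ m + d·2^{−t}∕3` for `d ≤ 7·8^t`. [folklore] -/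
theorem barrier_block_growth (hC : 0 < C) (hℓ : IsBarrier bOct C A Y ℓ) {t : ℕ} (hm : 9 / 4 * C ^ 2 * 4 ^ t ≤ ℓ (bs8 t)) :
    ∀ d, d ≤ 7 * 8 ^ t → ℓ (bs8 t) + d * (1 / 2 ^ t / 3) ≤ ℓ (bs8 t + d) := by
  set m := ℓ (bs8 t) with hmdef
  have h2t : (0 : ℝ) < 2 ^ t := by positivity
  have hmpos : 0 < m := lt_of_lt_of_le (by positivity) hm
  have hq : (3 / 2 * C * 2 ^ t) ^ 2 = 9 / 4 * C ^ 2 * 4 ^ t := by rw [(show (4 : ℝ) ^ t = (2 ^ t) ^ 2 by rw [← pow_mul, mul_comm, pow_mul]; norm_num)]; ring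
  have hsq : 3 / 2 * C * 2 ^ t ≤ Real.sqrt m := (Real.le_sqrt (by positivity) hmpos.le).mpr (by rw [hq]; exact hm)
  have hhelp : C / Real.sqrt m ≤ 2 / 3 * (1 / 2 ^ t) := by
    rw [div_le_iff₀ (Real.sqrt_pos.mpr hmpos)]
    have e : 2 / 3 * (1 / 2 ^ t) * (3 / 2 * C * 2 ^ t) = C := by
      rw [show 2 / 3 * (1 / 2 ^ t) * (3 / 2 * C * 2 ^ t) = C * (2 ^ t / 2 ^ t) by ring, div_self h2t.ne', mul_one]
    calc C = 2 / 3 * (1 / 2 ^ t) * (3 / 2 * C * 2 ^ t) := e.symm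
      _ ≤ 2 / 3 * (1 / 2 ^ t) * Real.sqrt m := mul_le_mul_of_nonneg_left hsq (by positivity)
  intro d
  induction d with
  | zero => intro _; simp [hmdef]
  | succ d ih =>
    intro hd
    have hprev := ih (by omega)
    set i := bs8 t + d with hidef
    have hi2 : i < bs8 (t + 1) := by rw [bs8_succ]; omega
    have hbi : bOct i ≤ -(1 / 2 ^ t) := bOct_le_of_mem (by omega) hi2
    have hℓi : m ≤ ℓ i := le_trans (le_add_of_nonneg_right (by positivity)) hprev
    have hhelpi : C / Real.sqrt (ℓ i) ≤ 2 / 3 * (1 / 2 ^ t) :=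
      (div_le_div_of_nonneg_left hC.le (Real.sqrt_pos.mpr hmpos) (Real.sqrt_le_sqrt hℓi)).trans hhelp
    have hstep := hℓ.2.2 i
    rw [show bs8 t + (d + 1) = i + 1 by omega]
    push_cast
    linarith

/-- **THE HEIGHT `(9∕4)C²·4^t` REPRODUCES ITSELF WHEN `C² ≤ 28∕81`**: the block gain `(7∕3)·4^t` is `≥ (27∕4)C²·4^t`. [folklore] -/
theorem barrier_height_succ (hC : 0 < C) (hC2 : C ^ 2 ≤ 28 / 81) (hℓ : IsBarrier bOct C A Y ℓ) {t : ℕ}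
    (hm : 9 / 4 * C ^ 2 * 4 ^ t ≤ ℓ (bs8 t)) : 9 / 4 * C ^ 2 * 4 ^ (t + 1) ≤ ℓ (bs8 (t + 1)) := by
  have h := barrier_block_growth hC hℓ hm (7 * 8 ^ t) le_rfl
  rw [← bs8_succ] at h
  have e : ((7 * 8 ^ t : ℕ) : ℝ) * (1 / 2 ^ t / 3) = 7 / 3 * 4 ^ t := by
    push_cast; rw [eight_pow]; field_simp
  have hc : C ^ 2 * 4 ^ t ≤ 28 / 81 * 4 ^ t := mul_le_mul_of_nonneg_right hC2 (by positivity)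
  rw [show (4 : ℝ) ^ (t + 1) = 4 ^ t * 4 from pow_succ 4 t]
  linarith

/-- **NO BOUNDED SUBSOLUTION FOR `C² ≤ 28∕81`** · every barrier for `(bOct, C)` above the level `(9∕4)C²` has `ℓ(8^t − 1) ≥ (9∕4)C²·4^t` for all
`t`, contradicting its ceiling `Y`. [folklore] -/
theorem no_barrier_bOct (hC : 0 < C) (hC2 : C ^ 2 ≤ 28 / 81) (hA : 9 / 4 * C ^ 2 ≤ A) : ¬ IsBarrier bOct C A Y ℓ := by
  intro hℓ
  have hgrow : ∀ t : ℕ, 9 / 4 * C ^ 2 * 4 ^ t ≤ ℓ (bs8 t) := by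
    intro t
    induction t with
    | zero => simpa [bs8] using hA.trans (hℓ.1 0)
    | succ t ih => exact barrier_height_succ hC hC2 hℓ ih
  obtain ⟨t, ht⟩ := pow_unbounded_of_one_lt (Y / (9 / 4 * C ^ 2)) (by norm_num : (1 : ℝ) < 4)
  have hY := (hgrow t).trans (hℓ.2.1 (bs8 t))
  have hc : (0 : ℝ) < 9 / 4 * C ^ 2 := by positivity
  rw [div_lt_iff₀ hc] at ht
  linarith

/-- **THE OCTAL STAIRCASE IS IMPOSSIBLE ON THE LINEAR ROAD FOR EVERY `C` WITH `C² ≤ 28∕81`** (`C ≤ 2√7∕9 ≈ 0.588`; every box) — IN PLACE OF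
GEN 10's `C ≤ 1∕2`. [cite: Balaban1987RG1, Thm 2 p.259 (first sentence) and (2.12)–(2.14) p.268] -/
theorem not_endPossibleLin_bOct_of_sq_le (hC : 0 < C) (hC2 : C ^ 2 ≤ 28 / 81) {γ₀ : ℝ} (hγ₀ : 0 < γ₀) : ¬ EndPossibleLin bOct C γ₀ :=
  (not_endPossibleLin_iff_noBarrier hC.le hγ₀).mpr ⟨9 / 4 * C ^ 2, by positivity, fun _ _ => no_barrier_bOct hC hC2 le_rfl⟩

/-- … in particular for every `0 < C ≤ 2√7∕9`. [cite: Balaban1987RG1, Thm 2 p.259 (first sentence) and (2.12)–(2.14) p.268] -/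
theorem not_endPossibleLin_bOct_of_le (hC : 0 < C) (hC' : C ≤ 2 * Real.sqrt 7 / 9) {γ₀ : ℝ} (hγ₀ : 0 < γ₀) : ¬ EndPossibleLin bOct C γ₀ := by
  have h7 : Real.sqrt 7 ^ 2 = 7 := Real.sq_sqrt (by norm_num)
  exact not_endPossibleLin_bOct_of_sq_le hC (by nlinarith [Real.sqrt_nonneg 7]) hγ₀

end Necessity

/-! ## §2 SUFFICIENCY by one Euler step per block: `C² > 7∕6` is possible -/

section Sufficiency

variable {C : ℝ}

/-- THE BACKWARD HEIGHT RECURSION `R(κ) = 4κ − 7 + (7C∕2)∕√κ`: the scaled entry height of block `t` that a piecewise-linear barrier can afford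
when block `t+1` is entered at scaled height `κ` (slope condition evaluated at the END of block `t`). [folklore] -/
def R (C κ : ℝ) : ℝ := 4 * κ - 7 + 7 / 2 * C / Real.sqrt κ

/-- The iterates `μ n := Rⁿ(C²)` (scaled entry heights, counted backward from the flattening block). [folklore] -/
def mu (C : ℝ) : ℕ → ℝ
  | 0 => C ^ 2
  | n + 1 => R C (mu C n)

/-- **ONE BLOCK GAINS `3C² − 7∕2`** · `R(κ) ≥ κ + (3C² − 7∕2)` for `κ ≥ C²` when `C² ≥ 7∕12` (`C > 0`):
`R(v²) − v² − 3C² + 7∕2 = (v − C)(3v² + 3Cv − 7∕2)∕v ≥ 0` for `v ≥ C`. [folklore] -/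
theorem R_ge (hC : 0 < C) (hC2 : 7 / 12 ≤ C ^ 2) {κ : ℝ} (hκ : C ^ 2 ≤ κ) : κ + (3 * C ^ 2 - 7 / 2) ≤ R C κ := by
  have hκpos : 0 < κ := lt_of_lt_of_le (by positivity) hκ
  obtain ⟨v, hvpos, rfl⟩ : ∃ v : ℝ, 0 < v ∧ κ = v ^ 2 := ⟨Real.sqrt κ, Real.sqrt_pos.mpr hκpos, (Real.sq_sqrt hκpos.le).symm⟩
  have hCv : C ≤ v := by
    have := Real.sqrt_le_sqrt hκ
    rwa [Real.sqrt_sq hC.le, Real.sqrt_sq hvpos.le] at this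
  unfold R
  rw [Real.sqrt_sq hvpos.le, ← sub_nonneg]
  have e : 4 * v ^ 2 - 7 + 7 / 2 * C / v - (v ^ 2 + (3 * C ^ 2 - 7 / 2)) = (v - C) * (3 * v ^ 2 + 3 * C * v - 7 / 2) / v := by
    field_simp; ring
  rw [e]
  apply div_nonneg _ hvpos.le
  apply mul_nonneg (by linarith)
  nlinarith

/-- `R(κ) ≤ 4κ` for `κ ≥ C²∕4` (`C > 0`): the heights `μ_n·4^{T−n}` are non-decreasing toward the flattening block. [folklore] -/
theorem R_le (hC : 0 < C) {κ : ℝ} (hκ : C ^ 2 / 4 ≤ κ) : R C κ ≤ 4 * κ := by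
  have hκpos : 0 < κ := lt_of_lt_of_le (by positivity) hκ
  have hsq : C / 2 ≤ Real.sqrt κ := (Real.le_sqrt (by positivity) hκpos.le).mpr (by linarith [hκ])
  have hspos : 0 < Real.sqrt κ := Real.sqrt_pos.mpr hκpos
  have h : 7 / 2 * C / Real.sqrt κ ≤ 7 := by
    rw [div_le_iff₀ hspos]; linarith
  unfold R; linarith

variable (hC : 0 < C) (hC2 : 7 / 12 ≤ C ^ 2)
include hC hC2

/-- The iterates grow at least linearly: `μ_n ≥ C² + n·(3C² − 7∕2)` (when `3C² ≥ 7∕2`). [folklore] -/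
theorem mu_ge (hC3 : 7 / 6 ≤ C ^ 2) : ∀ n : ℕ, C ^ 2 + n * (3 * C ^ 2 - 7 / 2) ≤ mu C n := by
  intro n
  induction n with
  | zero => simp [mu]
  | succ n ih =>
    have hκ : C ^ 2 ≤ mu C n := le_trans (le_add_of_nonneg_right (mul_nonneg n.cast_nonneg (by linarith))) ih
    have h := R_ge hC hC2 hκ
    show C ^ 2 + ((n + 1 : ℕ) : ℝ) * (3 * C ^ 2 - 7 / 2) ≤ R C (mu C n)
    push_cast; linarith

/-- `μ_n ≥ C²`. [folklore] -/
theorem sq_le_mu (hC3 : 7 / 6 ≤ C ^ 2) (n : ℕ) : C ^ 2 ≤ mu C n :=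
  le_trans (le_add_of_nonneg_right (mul_nonneg n.cast_nonneg (by linarith))) (mu_ge hC hC2 hC3 n)

/-- `μ_{n+1} ≤ 4·μ_n`. [folklore] -/
theorem mu_succ_le (hC3 : 7 / 6 ≤ C ^ 2) (n : ℕ) : mu C (n + 1) ≤ 4 * mu C n :=
  R_le hC (by linarith [sq_le_mu hC hC2 hC3 n, sq_nonneg C])

/-- `μ_n ≤ C²·4^n`. [folklore] -/
theorem mu_le (hC3 : 7 / 6 ≤ C ^ 2) : ∀ n : ℕ, mu C n ≤ C ^ 2 * 4 ^ n := by
  intro n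
  induction n with
  | zero => simp [mu]
  | succ n ih =>
    rw [show (4 : ℝ) ^ (n + 1) = 4 ^ n * 4 from pow_succ 4 n]
    have := mu_succ_le hC hC2 hC3 n
    nlinarith

end Sufficiency

/-! ### The piecewise-linear barrier with flattening block `T` -/

section Barrier

variable {C : ℝ} (hC : 0 < C) (hC3 : 7 / 6 < C ^ 2) (T : ℕ)

/-- Entry heights: `h_t := μ_{T−t}·4^t` for `t ≤ T`, `h_t := C²·4^T` beyond (the floor of the tail rate `2^{−T}`). [folklore] -/
def ht (C : ℝ) (T t : ℕ) : ℝ := if t ≤ T then mu C (T - t) * 4 ^ t else C ^ 2 * 4 ^ T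

/-- Slopes: `σ_t := (h_{t+1} − h_t)∕(7·8^t)` (zero beyond the flattening block). [folklore] -/
def slope (C : ℝ) (T t : ℕ) : ℝ := (ht C T (t + 1) - ht C T t) / (7 * 8 ^ t)

/-- THE BARRIER: linear interpolation of the entry heights inside each block. [folklore] -/
def ell (C : ℝ) (T : ℕ) (i : ℕ) : ℝ := ht C T (blk8 i) + ((i - bs8 (blk8 i) : ℕ) : ℝ) * slope C T (blk8 i)

/-- Beyond it: `h_t = C²·4^T` for `t ≥ T`. [folklore] -/
theorem ht_of_ge {t : ℕ} (h : T ≤ t) : ht C T t = C ^ 2 * 4 ^ T := by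
  rcases eq_or_lt_of_le h with rfl | hlt
  exacts [by simp [ht, mu], by simp [ht, not_le.mpr hlt]]

/-- The foot: `h_0 = μ_T`. [folklore] -/
theorem ht_zero : ht C T 0 = mu C T := by simp [ht]

/-- `h_{t+1} = h_t + 7·8^t·σ_t`. [folklore] -/
theorem ht_succ_eq (t : ℕ) : ht C T (t + 1) = ht C T t + (7 * 8 ^ t : ℝ) * slope C T t := by
  unfold slope; field_simp; ring

include hC hC3

/-- The heights are non-decreasing: `h_t ≤ h_{t+1}`. [folklore] -/
theorem ht_mono (t : ℕ) : ht C T t ≤ ht C T (t + 1) := by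
  by_cases h : t + 1 ≤ T
  · have e1 : ht C T t = mu C (T - t) * 4 ^ t := if_pos (by omega)
    have e2 : ht C T (t + 1) = mu C (T - (t + 1)) * 4 ^ (t + 1) := if_pos h
    rw [e1, e2, show T - t = T - (t + 1) + 1 by omega, show (4 : ℝ) ^ (t + 1) = 4 ^ t * 4 from pow_succ 4 t]
    have h4 : (0 : ℝ) < 4 ^ t := by positivity
    have := mu_succ_le hC (by linarith) hC3.le (T - (t + 1))
    calc mu C (T - (t + 1) + 1) * 4 ^ t ≤ 4 * mu C (T - (t + 1)) * 4 ^ t := mul_le_mul_of_nonneg_right this h4.le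
      _ = mu C (T - (t + 1)) * (4 ^ t * 4) := by ring
  · rw [ht_of_ge T (show T ≤ t by omega), ht_of_ge T (show T ≤ t + 1 by omega)]

/-- … hence bounded by the flat top: `h_t ≤ C²·4^T`. [folklore] -/
theorem ht_le (t : ℕ) : ht C T t ≤ C ^ 2 * 4 ^ T := by
  by_cases h : t ≤ T
  · have e1 : ht C T t = mu C (T - t) * 4 ^ t := if_pos h
    rw [e1]
    have h1 := mu_le hC (by linarith) hC3.le (T - t)
    have h4 : (0 : ℝ) < 4 ^ t := by positivity
    calc mu C (T - t) * 4 ^ t ≤ C ^ 2 * 4 ^ (T - t) * 4 ^ t := mul_le_mul_of_nonneg_right h1 h4.le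
      _ = C ^ 2 * 4 ^ T := by rw [mul_assoc, ← pow_add, show T - t + t = T by omega]
  · rw [ht_of_ge T (show T ≤ t by omega)]

/-- … and bounded below by the foot: `h_0 ≤ h_t`. [folklore] -/
theorem ht_zero_le : ∀ t : ℕ, ht C T 0 ≤ ht C T t := by
  intro t
  induction t with
  | zero => exact le_refl _
  | succ t ih => exact ih.trans (ht_mono hC hC3 T t)

/-- The slopes are non-negative. [folklore] -/
theorem slope_nonneg (t : ℕ) : 0 ≤ slope C T t :=
  div_nonneg (by linarith [ht_mono hC hC3 T t]) (by positivity)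

omit hC hC3 in
/-- The barrier steps by the slope of its block: `ℓ(i+1) = ℓ(i) + σ_{blk8 i}`. [folklore] -/
theorem ell_succ (i : ℕ) : ell C T (i + 1) = ell C T i + slope C T (blk8 i) := by
  obtain ⟨hlo, _⟩ := mem_block i
  rcases blk8_succ i with ⟨hblk, _⟩ | ⟨hblk, heq⟩
  · unfold ell; rw [hblk, show i + 1 - bs8 (blk8 i) = (i - bs8 (blk8 i)) + 1 by omega]; push_cast; ring
  · unfold ell
    rw [hblk, ← heq, Nat.sub_self, Nat.cast_zero, zero_mul, add_zero, ht_succ_eq T (blk8 i)]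
    have hlen : ((i - bs8 (blk8 i) : ℕ) : ℝ) = 7 * 8 ^ blk8 i - 1 := by
      have h1 : i - bs8 (blk8 i) = 7 * 8 ^ blk8 i - 1 := by have := bs8_succ (blk8 i); omega
      rw [h1, Nat.cast_sub (Nat.one_le_iff_ne_zero.mpr (by positivity)), Nat.cast_mul, Nat.cast_pow]; norm_num
    rw [hlen]; ring

/-- The barrier sits between consecutive entry heights: `h_{blk8 i} ≤ ℓ(i) ≤ h_{blk8 i + 1}`. [folklore] -/
theorem ht_le_ell_le (i : ℕ) : ht C T (blk8 i) ≤ ell C T i ∧ ell C T i ≤ ht C T (blk8 i + 1) := by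
  obtain ⟨hlo, hhi⟩ := mem_block i
  have hσ := slope_nonneg hC hC3 T (blk8 i)
  refine ⟨le_add_of_nonneg_right (mul_nonneg (Nat.cast_nonneg _) hσ), ?_⟩
  unfold ell
  rw [ht_succ_eq T (blk8 i)]
  have hlen : ((i - bs8 (blk8 i) : ℕ) : ℝ) ≤ 7 * 8 ^ blk8 i := by
    have h1 : i - bs8 (blk8 i) ≤ 7 * 8 ^ blk8 i := by have := bs8_succ (blk8 i); omega
    exact_mod_cast h1
  linarith [mul_le_mul_of_nonneg_right hlen hσ]

/-- **THE SLOPE CONDITION** · `2^{−t} − C∕√h_{t+1} ≤ σ_t`: EQUALITY before the flattening block (this is the definition of `R`), and `≤ 0 = σ_t`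
beyond it (the tail floor). [folklore] -/
theorem slope_cond (t : ℕ) : 1 / 2 ^ t - C / Real.sqrt (ht C T (t + 1)) ≤ slope C T t := by
  by_cases h : t + 1 ≤ T
  · set n := T - (t + 1) with hn
    have e2 : ht C T (t + 1) = mu C n * 4 ^ (t + 1) := if_pos h
    have e1 : ht C T t = R C (mu C n) * 4 ^ t := by
      rw [show ht C T t = mu C (T - t) * 4 ^ t from if_pos (by omega), show T - t = n + 1 by omega]; rfl
    have hμ : 0 < mu C n := lt_of_lt_of_le (by positivity) (sq_le_mu hC (by linarith) hC3.le n)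
    have hsq : Real.sqrt (ht C T (t + 1)) = Real.sqrt (mu C n) * 2 ^ (t + 1) := by rw [e2, sqrt_mul_four_pow hμ.le]
    have hspos : 0 < Real.sqrt (mu C n) := Real.sqrt_pos.mpr hμ
    unfold slope
    rw [hsq, e1, e2, R, show (4 : ℝ) ^ (t + 1) = 4 ^ t * 4 from pow_succ 4 t, show (2 : ℝ) ^ (t + 1) = 2 ^ t * 2 from pow_succ 2 t,
      eight_pow]
    apply le_of_eq
    field_simp
    ring
  · have hTt : T ≤ t := by omega
    have e1 := ht_of_ge (C := C) T hTt
    have e2 := ht_of_ge (C := C) T (show T ≤ t + 1 by omega)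
    unfold slope
    rw [e1, e2, sub_self, zero_div, sqrt_mul_four_pow (sq_nonneg C), Real.sqrt_sq hC.le, sub_nonpos,
      show C / (C * 2 ^ T) = 1 / 2 ^ T by rw [← div_div, div_self hC.ne']]
    exact one_div_le_one_div_of_le (by positivity) (pow_le_pow_right₀ (by norm_num) hTt)

/-- **THE INTERPOLANT IS A BARRIER** between `h_0 = μ_T` and the flat top `C²·4^T`. [folklore] -/
theorem isBarrier_ell : IsBarrier bOct C (ht C T 0) (C ^ 2 * 4 ^ T) (ell C T) := by
  refine ⟨fun i => (ht_zero_le hC hC3 T _).trans (ht_le_ell_le hC hC3 T i).1,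
    fun i => (ht_le_ell_le hC hC3 T i).2.trans (ht_le hC hC3 T _), fun i => ?_⟩
  rw [ell_succ T i, show bOct i = -(1 / 2 ^ blk8 i) from rfl]
  have hup := (ht_le_ell_le hC hC3 T i).2
  have hpos : 0 < ell C T i := by
    refine lt_of_lt_of_le ?_ ((ht_zero_le hC hC3 T _).trans (ht_le_ell_le hC hC3 T i).1)
    rw [ht_zero]; exact lt_of_lt_of_le (by positivity) (sq_le_mu hC (by linarith) hC3.le T)
  have hhelp : C / Real.sqrt (ht C T (blk8 i + 1)) ≤ C / Real.sqrt (ell C T i) :=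
    div_le_div_of_nonneg_left hC.le (Real.sqrt_pos.mpr hpos) (Real.sqrt_le_sqrt hup)
  have hsl := slope_cond hC hC3 T (blk8 i)
  linarith

/-- The foot reaches every level: `h_0 = μ_T ≥ C² + T·(3C² − 7∕2)`. [folklore] -/
theorem ht_zero_ge : C ^ 2 + T * (3 * C ^ 2 - 7 / 2) ≤ ht C T 0 := by
  rw [ht_zero]; exact mu_ge hC (by linarith) hC3.le T

end Barrier

/-- **THE OCTAL STAIRCASE IS POSSIBLE ON THE LINEAR ROAD FOR EVERY `C` WITH `C² > 7∕6`** (`C > √(7∕6) ≈ 1.080`; every box) — IN PLACE OF GEN 10's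
`C ≥ 2`: at level `A` flatten at the block `T` with `C² + T(3C² − 7∕2) ≥ A`. [cite: Balaban1987RG1, Thm 2 p.259 (first sentence) and (2.12)–(2.14) p.268] -/
theorem endPossibleLin_bOct_of_lt_sq {C : ℝ} (hC : 0 < C) (hC3 : 7 / 6 < C ^ 2) {γ₀ : ℝ} (hγ₀ : 0 < γ₀) : EndPossibleLin bOct C γ₀ := by
  refine (endPossibleLin_iff_barrier hC.le hγ₀).mpr fun A _ => ?_
  have hδ : 0 < 3 * C ^ 2 - 7 / 2 := by linarith
  obtain ⟨T, hT⟩ := exists_nat_ge ((A - C ^ 2) / (3 * C ^ 2 - 7 / 2))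
  refine ⟨C ^ 2 * 4 ^ T, ell C T, (isBarrier_ell hC hC3 T).mono_level ?_⟩
  have h1 := ht_zero_ge hC hC3 T
  rw [div_le_iff₀ hδ] at hT
  linarith

/-- … in particular for every `C > √(7∕6)`. [cite: Balaban1987RG1, Thm 2 p.259 (first sentence) and (2.12)–(2.14) p.268] -/
theorem endPossibleLin_bOct_of_gt {C : ℝ} (hC' : Real.sqrt (7 / 6) < C) {γ₀ : ℝ} (hγ₀ : 0 < γ₀) : EndPossibleLin bOct C γ₀ := by
  have h0 : 0 < C := lt_trans (Real.sqrt_pos.mpr (by norm_num)) hC'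
  have h7 : Real.sqrt (7 / 6) ^ 2 = 7 / 6 := Real.sq_sqrt (by norm_num)
  exact endPossibleLin_bOct_of_lt_sq h0 (by nlinarith [Real.sqrt_nonneg (7 / 6)]) hγ₀

/-! ## §3 The threshold, squeezed -/

/-- **THE OCTAL THRESHOLD, SQUEEZED** · the admissible constants of `bOct` form an up-set with threshold `C⋆ ∈ [2√7∕9, √(7∕6)]` (any box): possible
for every `C > C⋆`, impossible for every `0 < C < C⋆` — IN PLACE OF GEN 10's `[1∕2, 2]` (`EndDrawdownLinearThreshold.exists_threshold_bOct`).
[folklore] -/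
theorem exists_threshold_bOct_renorm {γ₀ : ℝ} (hγ₀ : 0 < γ₀) :
    ∃ Cstar : ℝ, 2 * Real.sqrt 7 / 9 ≤ Cstar ∧ Cstar ≤ Real.sqrt (7 / 6) ∧ (∀ C, Cstar < C → EndPossibleLin bOct C γ₀) ∧
      ∀ C, 0 < C → C < Cstar → ¬ EndPossibleLin bOct C γ₀ := by
  set S : Set ℝ := {C | 0 < C ∧ EndPossibleLin bOct C γ₀} with hS
  have hmem : ∀ C, Real.sqrt (7 / 6) < C → C ∈ S := fun C hC =>
    ⟨lt_trans (Real.sqrt_pos.mpr (by norm_num)) hC, endPossibleLin_bOct_of_gt hC hγ₀⟩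
  have hlow : ∀ C ∈ S, 2 * Real.sqrt 7 / 9 ≤ C := fun C hC =>
    le_of_not_gt fun hlt => not_endPossibleLin_bOct_of_le hC.1 hlt.le hγ₀ hC.2
  have hne : S.Nonempty := ⟨Real.sqrt (7 / 6) + 1, hmem _ (by linarith)⟩
  have hbdd : BddBelow S := ⟨2 * Real.sqrt 7 / 9, hlow⟩
  refine ⟨sInf S, le_csInf hne hlow, ?_, fun C hC => ?_, fun C hC0 hC hP => ?_⟩
  · exact le_of_forall_pos_le_add fun ε hε => csInf_le hbdd (hmem _ (by linarith))
  · obtain ⟨C', hC'S, hC'C⟩ := exists_lt_of_csInf_lt hne hC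
    exact endPossibleLin_mono hC'C.le hC'S.2
  · exact absurd (csInf_le hbdd ⟨hC0, hP⟩) (not_le.mpr hC)

end

end Summit.QuantumFields.BalabanUV.Gaps.EndDrawdownLinearThresholdRenorm
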